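import Literature.NumberTheory.Sieve.LevelOfDistribution
import Mathlib.Analysis.SpecialFunctions.Pow.Asymptotics

/-!
# `ElliottHalberstam` (stmt-Parity-14092): the trivial floor of the Bombieri–Vinogradov sum;
# `θ < 1` and the `ε`-slack are load-bearing; no saving below the level

Negative lemmas for the crux `LiouvilleShiftedTables.ElliottHalberstam` (= `LiouvilleMAD.ElliottHalberstam`
= the Literature constant `Literature.NumberTheory.Sieve.LevelOfDistribution.ElliottHalberstam`, all by
`rfl`), landed verbatim from the cdisprove work file `Cruxes/ElliottHalberstam/Disproof.lean` (§1–§4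
there) so that planners, ideators and auditors can import them. The crux itself — the Elliott–Halberstam
conjecture `∀ θ < 1, PrimesHaveLevel θ` — is a named open conjecture and is NOT refuted; what is proved:

* §1 `half_le_primeAPError`, `sum_primeAPError_ge`: `E*(x;q) ≥ 1/2` for `3 ≤ q ≤ 2x` (witness
  `y = q/2`, `a = −1`), so `Σ_{q ≤ Q} E*(x;q) ≥ (Q − 2)/2` for `Q ≤ 2x`.
* §2 `elliottHalberstam_false_without_ltOne`, `not_primesHaveLevel_of_one_lt`: `θ < 1` dropped ⇒ false.
* §3 `PrimesHaveLevelFun L` (exact level, `∀ A` shape): `not_primesHaveLevelFun_of_ge` (any level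
  eventually `≥ x/(log x)^B`), `not_primesHaveLevelFun_logPower`, `not_primesHaveSharpLevel_one`
  (`ε` dropped at `θ = 1`), and `primesHaveSharpLevel_of_lt` (sharp level below `θ` from level `θ`).
* §4 `not_isBigO_sum_primeAPError_rpow`: at level `x^τ`, `0 < τ ≤ 1`, the sum is not `O(x^σ)`, `σ < τ`.
Companions: `ElliottHalberstamCoprime` (coprimality load-bearing), `ElliottHalberstamStructure`.
[folklore]
-/

namespace Summit.Parity.GeneralizedHardyLittlewood.Theorems.ElliottHalberstam.Negative

open Filter Asymptotics Finset Real
open Literature.NumberTheory.Sieve Literature.NumberTheory.Sieve.LevelOfDistribution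

/-! ## §1 The trivial floor `E*(x;q) ≥ 1/2` -/

/-- For `q ≥ 3` the class `−1 (mod q)` contains no `n ≤ q/2`, so `ψ(q/2; q, −1) = 0`. -/
theorem chebyshevPsiMod_neg_one_half_eq_zero {q : ℕ} (hq : 3 ≤ q) :
    chebyshevPsiMod q (-1) ((q : ℝ) / 2) = 0 := by
  unfold chebyshevPsiMod
  refine Finset.sum_eq_zero fun n hn => ?_
  rw [Finset.mem_range] at hn
  have hn2 : n ≤ ⌊(q : ℝ) / 2⌋₊ := by omega
  have hn3 : (n : ℝ) ≤ (q : ℝ) / 2 := (Nat.le_floor_iff (by positivity)).mp hn2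
  have hn4 : 2 * n ≤ q := by
    have : (2 * n : ℝ) ≤ q := by linarith
    exact_mod_cast this
  simp only [ArithmeticFunction.vonMangoldt.residueClass, Set.indicator_apply, Set.mem_setOf_eq]
  split_ifs with h
  · exfalso
    have h' : ((n + 1 : ℕ) : ZMod q) = 0 := by push_cast; rw [h]; ring
    rw [ZMod.natCast_eq_zero_iff] at h'
    have := Nat.le_of_dvd (Nat.succ_pos n) h'
    omega
  · rfl

/-- **Trivial floor.** `E*(x;q) ≥ 1/2` for every `3 ≤ q ≤ 2x`
(witness `y = q/2 ∈ [1,x]`, `a = −1`: `|0 − (q/2)/φ(q)| ≥ 1/2` as `φ(q) ≤ q`). -/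
theorem half_le_primeAPError {q : ℕ} (hq : 3 ≤ q) {x : ℝ} (hqx : (q : ℝ) ≤ 2 * x) :
    (1 / 2 : ℝ) ≤ primeAPError x q := by
  have hq0 : q ≠ 0 := by omega
  haveI : NeZero q := ⟨hq0⟩
  have hq3 : (3 : ℝ) ≤ q := by exact_mod_cast hq
  have hy1 : (1 : ℝ) ≤ (q : ℝ) / 2 := by linarith
  have hyx : (q : ℝ) / 2 ≤ x := by linarith
  have key := abs_sub_le_primeAPError (x := x) hq0 hy1 hyx (-1)
  rw [Units.val_neg, Units.val_one, chebyshevPsiMod_neg_one_half_eq_zero hq, zero_sub,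
    abs_neg] at key
  refine le_trans ?_ ((le_abs_self _).trans key)
  have hφpos : (0 : ℝ) < (Nat.totient q : ℝ) := by
    exact_mod_cast Nat.totient_pos.mpr (Nat.pos_of_ne_zero hq0)
  have hφle : (Nat.totient q : ℝ) ≤ q := by exact_mod_cast Nat.totient_le q
  rw [div_div, le_div_iff₀ (by positivity)]
  linarith

/-- **Floor for the Bombieri–Vinogradov sum.** `Σ_{1 ≤ q ≤ Q} E*(x;q) ≥ (Q − 2)/2` whenever
`Q ≤ 2x`: no level-`Q` statement of this shape can claim a bound below `≍ Q`. -/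
theorem sum_primeAPError_ge {Q : ℕ} {x : ℝ} (hQx : (Q : ℝ) ≤ 2 * x) :
    ((Q : ℝ) - 2) / 2 ≤ ∑ q ∈ Icc 1 Q, primeAPError x q := by
  calc ((Q : ℝ) - 2) / 2 ≤ ∑ q ∈ Icc 3 Q, (1 / 2 : ℝ) := by
        rw [Finset.sum_const, Nat.card_Icc, nsmul_eq_mul]
        have : ((Q : ℝ) - 2) ≤ ((Q + 1 - 3 : ℕ) : ℝ) := by
          rcases le_or_gt 2 Q with h | h
          · rw [Nat.cast_sub (by omega)]; push_cast; linarith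
          · have : (Q : ℝ) < 2 := by exact_mod_cast h
            linarith [(Nat.cast_nonneg (Q + 1 - 3) : (0 : ℝ) ≤ _)]
        linarith
    _ ≤ ∑ q ∈ Icc 3 Q, primeAPError x q := Finset.sum_le_sum fun q hq => by
        rw [Finset.mem_Icc] at hq
        exact half_le_primeAPError hq.1 (le_trans (by exact_mod_cast hq.2) hQx)
    _ ≤ ∑ q ∈ Icc 1 Q, primeAPError x q :=
        Finset.sum_le_sum_of_subset_of_nonneg (Finset.Icc_subset_Icc (by norm_num) le_rfl)
          fun q _ _ => primeAPError_nonneg x q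

/-! ## §2 Load-bearing hypothesis `θ < 1` -/

/-- The crux with the hypothesis `θ < 1` DROPPED. -/
def ElliottHalberstamWithoutLtOne : Prop :=
  ∀ θ : ℝ, PrimesHaveLevel θ

/-- Any proof of the crux must use `θ < 1` (precisely: `θ ≤ 1`): without it the statement is false,
since `PrimesHaveLevel θ` forces `θ ≤ 1` (`PrimesHaveLevel.le_one`, tree). -/
theorem elliottHalberstam_false_without_ltOne : ¬ ElliottHalberstamWithoutLtOne := fun h =>
  absurd (PrimesHaveLevel.le_one (h 2)) (by norm_num)

/-- Every single exponent `θ > 1` fails. -/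
theorem not_primesHaveLevel_of_one_lt {θ : ℝ} (hθ : 1 < θ) : ¬ PrimesHaveLevel θ := fun h =>
  absurd (PrimesHaveLevel.le_one h) (not_le.mpr hθ)

/-! ## §3 Load-bearing `ε`-slack: exact levels, log-power levels -/

/-- The Bombieri–Vinogradov `∀ A` shape at modulus level `L(x)` EXACTLY (no `ε`). -/
def PrimesHaveLevelFun (L : ℝ → ℝ) : Prop :=
  ∀ A : ℝ, 0 < A →
    (fun x : ℝ => ∑ q ∈ Icc 1 ⌊L x⌋₊, primeAPError x q) =O[atTop] fun x : ℝ => x / Real.log x ^ A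

/-- `PrimesHaveLevel θ` is `PrimesHaveLevelFun (x ↦ x^{θ−ε})` for every `ε > 0` (binder swap). -/
theorem primesHaveLevel_iff_forall_eps (θ : ℝ) :
    PrimesHaveLevel θ ↔ ∀ ε : ℝ, 0 < ε → PrimesHaveLevelFun fun x => x ^ (θ - ε) :=
  ⟨fun h ε hε A hA => h A hA ε hε, fun h A hA ε hε => h ε hε A hA⟩

/-- **Any level `≥ x/(log x)^B` (eventually, with `L ≤ 2x`) is false in the `∀ A` shape**: the floor
`Σ ≥ (L − 3)/2 ≥ (x/(log x)^B − 3)/2` beats `C x/(log x)^{B+1}`. -/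
theorem not_primesHaveLevelFun_of_ge {L : ℝ → ℝ} {B : ℝ} (hB : 0 ≤ B)
    (hL : ∀ᶠ x in atTop, x / Real.log x ^ B ≤ L x ∧ L x ≤ 2 * x) :
    ¬ PrimesHaveLevelFun L := by
  intro h
  obtain ⟨C, hC, hCb⟩ := (h (B + 1) (by linarith)).exists_pos
  have hev := hCb.bound
  have hlog : ∀ᶠ x : ℝ in atTop, 4 * C + 8 ≤ Real.log x :=
    Real.tendsto_log_atTop.eventually_ge_atTop _
  have hpow : ∀ᶠ x : ℝ in atTop, Real.log x ^ (B + 1) ≤ x := by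
    have hlo := (isLittleO_log_rpow_rpow_atTop (B + 1) one_pos).bound one_pos
    filter_upwards [hlo, eventually_ge_atTop (1 : ℝ)] with x hx hx1
    rw [one_mul, Real.rpow_one, Real.norm_eq_abs, Real.norm_eq_abs,
      abs_of_nonneg (show (0 : ℝ) ≤ x by linarith)] at hx
    exact (le_abs_self _).trans hx
  obtain ⟨x, hxb, ⟨hLlo, hLhi⟩, hxlog, hxpow, hx3⟩ :=
    (hev.and (hL.and (hlog.and (hpow.and (eventually_ge_atTop (3 : ℝ)))))).exists
  have hx0 : 0 < x := by linarith
  have hlogpos : 0 < Real.log x := by linarith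
  set ℓ := Real.log x with hℓ
  set P := ℓ ^ B with hP_def
  have hP : 0 < P := Real.rpow_pos_of_pos hlogpos B
  have hPℓ : ℓ ^ (B + 1) = P * ℓ := by rw [hP_def, Real.rpow_add hlogpos, Real.rpow_one]
  -- upper bound from the `O(·)` hypothesis
  have hS0 : 0 ≤ ∑ q ∈ Icc 1 ⌊L x⌋₊, primeAPError x q :=
    Finset.sum_nonneg fun q _ => primeAPError_nonneg x q
  have hU : ∑ q ∈ Icc 1 ⌊L x⌋₊, primeAPError x q ≤ C * (x / (P * ℓ)) := by
    have := hxb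
    rw [Real.norm_eq_abs, Real.norm_eq_abs, abs_of_nonneg hS0, hPℓ,
      abs_of_nonneg (div_nonneg hx0.le (by positivity))] at this
    exact this
  -- lower bound from the floor
  have hL0 : 0 ≤ L x := le_trans (div_nonneg hx0.le hP.le) hLlo
  have hfloor_le : ((⌊L x⌋₊ : ℕ) : ℝ) ≤ 2 * x := (Nat.floor_le hL0).trans hLhi
  have hfloor_ge : L x - 1 ≤ ((⌊L x⌋₊ : ℕ) : ℝ) := by linarith [Nat.lt_floor_add_one (L x)]
  have hLo : (x / P - 3) / 2 ≤ ∑ q ∈ Icc 1 ⌊L x⌋₊, primeAPError x q := by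
    have := sum_primeAPError_ge (x := x) hfloor_le
    linarith
  -- combine: x/P - 3 ≤ 2 C x/(P ℓ); multiply by P
  have key : x / P - 3 ≤ 2 * C * (x / (P * ℓ)) := by linarith
  have e1 : P * (x / P - 3) = x - 3 * P := by field_simp
  have e2 : P * (2 * C * (x / (P * ℓ))) = 2 * C * (x / ℓ) := by field_simp
  have key2 : x - 3 * P ≤ 2 * C * (x / ℓ) := by
    have := mul_le_mul_of_nonneg_left key hP.le
    rwa [e1, e2] at this
  -- 2C x/ℓ ≤ x/2 since ℓ ≥ 4C + 8
  have key3 : 2 * C * (x / ℓ) ≤ x / 2 := by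
    rw [mul_div_assoc', div_le_div_iff₀ hlogpos (by norm_num : (0:ℝ) < 2)]
    nlinarith
  -- P ℓ ≤ x hence P ≤ x / ℓ ≤ x / 8
  have key4 : P * ℓ ≤ x := by rw [← hPℓ]; exact hxpow
  have key5 : P ≤ x / 8 := by
    rw [le_div_iff₀ (by norm_num : (0:ℝ) < 8)]
    nlinarith
  linarith

/-- **Level `x/(log x)^B` is false** (every `B ≥ 0`) in the `∀ A` shape (trivially: take `A = B + 1`
against the floor). The substantive irregularity at that level — failure of the asymptotic
`ψ(x;q,a) ∼ x/φ(q)` itself for some `q ≤ x/(log x)^B` — is Friedlander–Granville, Ann. of Math. 129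
(1989) (tree: `Literature.Barriers.Parity.EquidistributionLimitBarrier`, weak form
`FriedlanderGranville1989_weak`). -/
theorem not_primesHaveLevelFun_logPower {B : ℝ} (hB : 0 ≤ B) :
    ¬ PrimesHaveLevelFun fun x => x / Real.log x ^ B := by
  refine not_primesHaveLevelFun_of_ge hB ?_
  filter_upwards [eventually_ge_atTop (Real.exp 1)] with x hx
  have hx0 : 0 < x := lt_of_lt_of_le (Real.exp_pos 1) hx
  have hlog1 : 1 ≤ Real.log x := by
    have := Real.log_le_log (Real.exp_pos 1) hx
    rwa [Real.log_exp] at this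
  refine ⟨le_rfl, ?_⟩
  have h1 : 1 ≤ Real.log x ^ B := Real.one_le_rpow hlog1 hB
  calc x / Real.log x ^ B ≤ x := div_le_self hx0.le h1
    _ ≤ 2 * x := by linarith

/-- Level `x^θ` EXACTLY (the Polymath GEH-style modulus range `q ≤ x^θ`, no `ε`). -/
def PrimesHaveSharpLevel (θ : ℝ) : Prop :=
  PrimesHaveLevelFun fun x => x ^ θ

/-- **The endpoint is false**: level `x` exactly (`θ = 1`, `ε` dropped) fails — trivially, by the
floor. So the `ε` (equivalently `θ < 1`) in the crux cannot be removed. -/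
theorem not_primesHaveSharpLevel_one : ¬ PrimesHaveSharpLevel 1 := by
  refine not_primesHaveLevelFun_of_ge (B := 0) le_rfl ?_
  filter_upwards [eventually_ge_atTop (0 : ℝ)] with x hx
  rw [Real.rpow_zero, div_one, Real.rpow_one]
  exact ⟨le_rfl, by linarith⟩

/-- Sharp level `x^{θ'}` follows from `PrimesHaveLevel θ` for every `θ' < θ` (take `ε = θ − θ'`). -/
theorem primesHaveSharpLevel_of_lt {θ θ' : ℝ} (h : PrimesHaveLevel θ) (hlt : θ' < θ) :
    PrimesHaveSharpLevel θ' := by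
  intro A hA
  have h' := h A hA (θ - θ') (by linarith)
  have e : θ - (θ - θ') = θ' := by ring
  rw [e] at h'
  exact h'

/-! ## §4 Tightness of the saving: no power saving below the level -/

/-- **No bound below the level.** At modulus level `x^τ` (`0 < τ ≤ 1`) the Bombieri–Vinogradov sum
is not `O(x^σ)` for any `σ < τ` (floor `≥ (x^τ − 3)/2`). In particular "EH with power saving
`x^{1−δ}` at level `x^{θ−ε}`" is false whenever `1 − δ < θ − ε`. -/
theorem not_isBigO_sum_primeAPError_rpow {τ σ : ℝ} (hτ0 : 0 < τ) (hτ1 : τ ≤ 1) (hσ : σ < τ) :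
    ¬ ((fun x : ℝ => ∑ q ∈ Icc 1 ⌊x ^ τ⌋₊, primeAPError x q) =O[atTop] fun x : ℝ => x ^ σ) := by
  intro h
  obtain ⟨C, hC, hCb⟩ := h.exists_pos
  have hev := hCb.bound
  have hgap : ∀ᶠ x : ℝ in atTop, 4 * C + 4 ≤ x ^ (τ - σ) :=
    (tendsto_rpow_atTop (by linarith : 0 < τ - σ)).eventually_ge_atTop _
  have hbig : ∀ᶠ x : ℝ in atTop, 7 ≤ x ^ τ := (tendsto_rpow_atTop hτ0).eventually_ge_atTop _
  obtain ⟨x, hxb, hxgap, hxbig, hx1⟩ :=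
    (hev.and (hgap.and (hbig.and (eventually_ge_atTop (1 : ℝ))))).exists
  have hx0 : 0 < x := by linarith
  have hS0 : 0 ≤ ∑ q ∈ Icc 1 ⌊x ^ τ⌋₊, primeAPError x q :=
    Finset.sum_nonneg fun q _ => primeAPError_nonneg x q
  have hσpos : 0 < x ^ σ := Real.rpow_pos_of_pos hx0 σ
  have hU : ∑ q ∈ Icc 1 ⌊x ^ τ⌋₊, primeAPError x q ≤ C * x ^ σ := by
    have := hxb
    rw [Real.norm_eq_abs, Real.norm_eq_abs, abs_of_nonneg hS0, abs_of_pos hσpos] at this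
    exact this
  have hτx : x ^ τ ≤ x := by
    calc x ^ τ ≤ x ^ (1 : ℝ) := Real.rpow_le_rpow_of_exponent_le hx1 hτ1
      _ = x := Real.rpow_one x
  have hτ0' : 0 ≤ x ^ τ := (Real.rpow_pos_of_pos hx0 τ).le
  have hfloor_le : ((⌊x ^ τ⌋₊ : ℕ) : ℝ) ≤ 2 * x := by
    linarith [Nat.floor_le hτ0']
  have hfloor_ge : x ^ τ - 1 ≤ ((⌊x ^ τ⌋₊ : ℕ) : ℝ) := by linarith [Nat.lt_floor_add_one (x ^ τ)]
  have hLo : (x ^ τ - 3) / 2 ≤ ∑ q ∈ Icc 1 ⌊x ^ τ⌋₊, primeAPError x q := by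
    have := sum_primeAPError_ge (x := x) hfloor_le
    linarith
  have hdecomp : x ^ τ = x ^ σ * x ^ (τ - σ) := by
    rw [← Real.rpow_add hx0]; ring_nf
  -- x^τ - 3 ≤ 2 C x^σ and (4C+4) x^σ ≤ x^τ
  have k1 : x ^ τ - 3 ≤ 2 * C * x ^ σ := by linarith
  have k2 : (4 * C + 4) * x ^ σ ≤ x ^ τ := by
    rw [hdecomp]; nlinarith
  nlinarith

end Summit.Parity.GeneralizedHardyLittlewood.Theorems.ElliottHalberstam.Negative
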